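import Summits.QuantumFields.BalabanUV.Beta.GAN24.OneStepConstraintLetters
import Summits.QuantumFields.BalabanUV.Beta.GAN24.EffectiveFormLocalisationLatticeLetters

/-!
# `BalabanUV.Beta.GAN24.OneStepConstraintLettersReg` — binder row G-an2-4 ∕ (CONV-C), routes C-R6° («VALUES») × R7 («TWO CURRENCIES»), PART 169:
# THE ONE-STEP CONSTRAINT LETTERS OF BAŁABAN's AVERAGING `QB N R M`, II — PART 105 §4's block compatibilities IN ITS LITERAL SHAPE (`ρ = tdist` on coarse sites,
# `D = tdist ∘ par`, `σ = tdist(par ·, ·)`, `R = 2`, `R′ = 1`), the regulariser `(re QB)ᵀ(a•1)(re QB)` (block-local, entries `≤ |a|R^{−2d}`), and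
# «KERNEL COERCIVITY ⟹ PART 105's `hK`» (generic, then for `QB` with the corner lift) (unit b2b-balaban-gan24-p3, gen 58; v1)

NOT IN PRINT; OUR PROOF ([folklore] BY NAME over PART 168 `OneStepConstraintLetters` (support, mask value, row ∕ column mass, the corner lift), PART 105
`EffectiveFormLocalisation.form_reg ∕ transpose_mul_smul_one_mul`, PART 108 `EffectiveFormLocalisationLatticeLetters.form_sub_le`, and `Beta.VectorTailsCov` (`tdist_triangle ∕ tdist_comm`).  [Balaban1984PropagatorsI] (1.11) p. 19, (1.18) p. 20 LOCATE the
averaging; [B9] (3.111) is the pattern of the `a`-term; nothing printed is a hypothesis.)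
HONEST FRAMING (cell contract, verbatim): «discharging `BetaPertH` makes Bałaban's UV stability UNCONDITIONAL — a real constructive-QFT result; it is NOT the continuum limit
and NOT the Clay problem.»  HONEST DEPENDENCY (verbatim): «continuum YM on T⁴ ⇐ BetaPertH ∧ nine spine estimates (0/9 proved); BetaPertH ⇐ (D1) ∧ (D4) ∧ CAP+tail; G-an2-4 gates
asym, D1 and NE2/3/4.»

WHY.  PART 105 (`abs_effForm_le ∕ abs_minOp_le ∕ abs_blockProp_le_of_resolvent ∕ abs_inv_mul_transpose_le_of_resolvent`) and PART 106 (`abs_flucCov_le`) consume, besides the soft letter and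
`hUB` (PART 168 `ub_QB`): the block compatibility `Q(b,x) ≠ 0 → Q(b′,x′) ≠ 0 → ρ(b,b′) ≤ D(x,x′) + R`, the fine-to-unit compatibility `Q(b′,x′) ≠ 0 → σ(x,b′) ≤ D(x,x′) + R′`, and the
coercivity `hK` of `K = H + Qᵀ(a•1)Q`; and the finite Combes–Thomas step for the soft letter needs `K`'s off-diagonal structure, i.e. the regulariser's entries and support.  THIS FILE
supplies all of these for `Q = re (QB N R M)` with the torus sup-distance `tdist` of `Beta.VectorTailsCov` (volume-uniform lattice sums: `sum_exp_tdist_le` there), leaving ONLY the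
model-side inputs (`H` symmetric, `0 ≤ ⟨u,Hu⟩ ≤ h|u|²`, kernel coercivity `γ₀` on `ker (re QB)`, entry decay of `H`) to the V195 adapter.

WHAT THIS FILE PROVES (0 sorry, 0 `def`; `N, R ≥ 1`, every torus `M`, every `d`):
* `par_of_reM_QB_ne_zero`, `tdist_par_le_one_of_reM_QB_ne_zero` (real readings of PART 168's support);
* **`tdist_le_tdist_par_add_two`** (PART 105 §4's `hQρ`, `R = 2`), **`tdist_par_le_tdist_par_add_one`** (`hQσ`, `R′ = 1`);
* **`reg_apply_eq_zero`** (`((re QB)ᵀ(a•1)(re QB))(x,x′) = 0` unless same component and `tdist(par x, par x′) ≤ 2`), **`abs_reg_apply_le`** (`≤ |a|·R^{−d}·R^{−d}`);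
* **`coercive_reg_of_ker`** (GENERIC: `H` symmetric, `0 ≤ ⟨u,Hu⟩ ≤ h|u|²`, `γ₀`-coercive on `ker Q`, a right inverse `E` with `|EB|² ≤ e₂|B|²`, `a > 0` ⟹
  `QGQInverse.Coercive (H + Qᵀ(a•1)Q) γ_K`, `γ_K⁻¹ = max (4∕γ₀) ((4h·e₂∕γ₀ + 2e₂)∕a)`), **`coercive_reg_QB`** (the instance `Q = re QB`, `E` = the corner lift, `e₂ = R^{2d}`).
WHAT IT IS NOT: as PART 168 — no model-side letter is discharged, no choice of V197's option, no k-uniformity beyond `R = L` fixed.  SUPPLIER work; NEVER «G-an2-4 closed»; NOT (CONV-C),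
NOT D1, NOT `BetaPertH`, NOT continuum, NOT Clay.  Records: `HOME/b2b-balaban-gan24-p3/gen58/README.md`.
-/

noncomputable section

open scoped BigOperators ComplexConjugate Matrix
open Finset Matrix

namespace Summit.QuantumFields.BalabanUV.Beta.GAN24.OneStepConstraintLettersReg

open Literature.MathematicalPhysics.QuantumFieldTheory.Balaban1983to89
open Literature.MathematicalPhysics.QuantumFieldTheory.Balaban1983to89.B5Prop11Plancherel (Tor fine unitVec)
open Literature.MathematicalPhysics.QuantumFieldTheory.Balaban1983to89.B5RealFields (IsReal reM reM_apply)
open Literature.MathematicalPhysics.QuantumFieldTheory.Balaban1983to89.Beta.VectorTailsCov (tdist tdist_self tdist_triangle tdist_comm)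
open Summit.QuantumFields.BalabanUV.T4Continuum.BalabanLineAverage (QB)
open Summit.QuantumFields.BalabanUV.T4Continuum.BalabanAveragedTowerModes (par rem)
open Summit.QuantumFields.BalabanUV.Beta.GAN24.OneStepConstraintLetters
open Summit.QuantumFields.BalabanUV.Beta.GAN24.EffectiveFormLocalisationLatticeLetters (form_sub_le)

variable {d : ℕ} (N R : ℕ) [NeZero N] [NeZero R] (M : Fin d → ℕ) [hM : ∀ μ, NeZero (M μ)]

/-! ## §1 Block compatibilities in the torus distance, the regulariser, kernel coercivity ⟹ coercivity (PART 105 ∕ 106 letters for `Q = re QB`) -/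

section Letters

/-- real reading of the block support: `(re QB)_{(y,μ),(x′,μ′)} ≠ 0 ⟹ μ′ = μ ∧ par x′ ∈ {y, y + e_μ}`. [folklore] -/
theorem par_of_reM_QB_ne_zero {i : Tor (fine N M) × Fin d} {x : Tor (fine (R * N) M) × Fin d} (h : reM (QB N R M) i x ≠ 0) :
    x.2 = i.2 ∧ (par N R M x.1 = i.1 ∨ par N R M x.1 = i.1 + unitVec (fine N M) i.2) :=
  par_of_QB_ne_zero N R M fun h0 => h (by rw [reM_apply, h0, Complex.zero_re])

/-- real reading of the block support in the coarse torus distance: `(re QB)_{(y,μ),x′} ≠ 0 ⟹ tdist(y, par x′) ≤ 1`. [folklore] -/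
theorem tdist_par_le_one_of_reM_QB_ne_zero {i : Tor (fine N M) × Fin d} {x : Tor (fine (R * N) M) × Fin d} (h : reM (QB N R M) i x ≠ 0) :
    tdist i.1 (par N R M x.1) ≤ 1 :=
  tdist_par_le_one_of_QB_ne_zero N R M fun h0 => h (by rw [reM_apply, h0, Complex.zero_re])

/-- **PART 105 §4's BLOCK COMPATIBILITY `hQρ` FOR BAŁABAN's AVERAGING**, with the coarse pseudo-distance `ρ(b,b′) = tdist(b,b′)`, the fine gauge `D(x,x′) = tdist(par x, par x′)`
(block distance) and `R = 2`: `(re QB)(b,x) ≠ 0 → (re QB)(b′,x′) ≠ 0 → tdist(b,b′) ≤ tdist(par x, par x′) + 2`. [folklore] -/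
theorem tdist_le_tdist_par_add_two {b b' : Tor (fine N M) × Fin d} {x x' : Tor (fine (R * N) M) × Fin d}
    (hb : reM (QB N R M) b x ≠ 0) (hb' : reM (QB N R M) b' x' ≠ 0) :
    (tdist b.1 b'.1 : ℝ) ≤ (tdist (par N R M x.1) (par N R M x'.1) : ℝ) + 2 := by
  have h1 := tdist_par_le_one_of_reM_QB_ne_zero N R M hb
  have h2 := tdist_par_le_one_of_reM_QB_ne_zero N R M hb'
  have h3 := tdist_triangle b.1 (par N R M x.1) b'.1
  have h4 := tdist_triangle (par N R M x.1) (par N R M x'.1) b'.1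
  rw [tdist_comm b'.1] at h2
  have h : tdist b.1 b'.1 ≤ tdist (par N R M x.1) (par N R M x'.1) + 2 := by omega
  exact_mod_cast h

/-- **PART 105 §4's FINE-TO-UNIT COMPATIBILITY `hQσ` FOR BAŁABAN's AVERAGING**, with `σ(x,b) = tdist(par x, b)`, `D(x,x′) = tdist(par x, par x′)` and `R′ = 1`:
`(re QB)(b′,x′) ≠ 0 → tdist(par x, b′) ≤ tdist(par x, par x′) + 1`. [folklore] -/
theorem tdist_par_le_tdist_par_add_one {b' : Tor (fine N M) × Fin d} (x : Tor (fine (R * N) M) × Fin d) {x' : Tor (fine (R * N) M) × Fin d}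
    (hb' : reM (QB N R M) b' x' ≠ 0) :
    (tdist (par N R M x.1) b'.1 : ℝ) ≤ (tdist (par N R M x.1) (par N R M x'.1) : ℝ) + 1 := by
  have h2 := tdist_par_le_one_of_reM_QB_ne_zero N R M hb'
  have h4 := tdist_triangle (par N R M x.1) (par N R M x'.1) b'.1
  rw [tdist_comm b'.1] at h2
  have h : tdist (par N R M x.1) b'.1 ≤ tdist (par N R M x.1) (par N R M x'.1) + 1 := by omega
  exact_mod_cast h

/-- **THE REGULARISER `(re QB)ᵀ(a•1)(re QB)` IS BLOCK-LOCAL**: its `(x,x′)` entry vanishes unless `x, x′` carry the same component and their blocks are within torus distance `2`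
(both lie on contours counted at one coarse bond). [folklore] -/
theorem reg_apply_eq_zero (a : ℝ) {x x' : Tor (fine (R * N) M) × Fin d}
    (h : ¬ (x.2 = x'.2 ∧ tdist (par N R M x.1) (par N R M x'.1) ≤ 2)) :
    ((reM (QB N R M))ᵀ * (a • (1 : Matrix (Tor (fine N M) × Fin d) (Tor (fine N M) × Fin d) ℝ)) * reM (QB N R M)) x x' = 0 := by
  rw [EffectiveFormLocalisation.transpose_mul_smul_one_mul, Matrix.smul_apply, Matrix.mul_apply, smul_eq_mul]
  refine mul_eq_zero_of_right _ (Finset.sum_eq_zero fun b _ => ?_)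
  rw [transpose_apply]
  by_cases hb : reM (QB N R M) b x = 0
  · rw [hb, zero_mul]
  by_cases hb' : reM (QB N R M) b x' = 0
  · rw [hb', mul_zero]
  exfalso
  apply h
  obtain ⟨hμ, -⟩ := par_of_reM_QB_ne_zero N R M hb
  obtain ⟨hμ', -⟩ := par_of_reM_QB_ne_zero N R M hb'
  have h1 := tdist_par_le_one_of_reM_QB_ne_zero N R M hb
  have h2 := tdist_par_le_one_of_reM_QB_ne_zero N R M hb'
  have h3 := tdist_triangle (par N R M x.1) b.1 (par N R M x'.1)
  rw [tdist_comm b.1] at h1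
  exact ⟨hμ.trans hμ'.symm, by omega⟩

/-- **THE REGULARISER's ENTRIES ARE BOUNDED**: `|((re QB)ᵀ(a•1)(re QB))(x,x′)| ≤ |a|·R^{−2d}` (entries `≤ R^{−d}`, column mass `R^{−d}`). [folklore] -/
theorem abs_reg_apply_le (a : ℝ) (x x' : Tor (fine (R * N) M) × Fin d) :
    |((reM (QB N R M))ᵀ * (a • (1 : Matrix (Tor (fine N M) × Fin d) (Tor (fine N M) × Fin d) ℝ)) * reM (QB N R M)) x x'| ≤
      |a| * (((R : ℝ) ^ d)⁻¹ * ((R : ℝ) ^ d)⁻¹) := by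
  rw [EffectiveFormLocalisation.transpose_mul_smul_one_mul, Matrix.smul_apply, Matrix.mul_apply, smul_eq_mul, abs_mul]
  refine mul_le_mul_of_nonneg_left ?_ (abs_nonneg a)
  calc |∑ b, (reM (QB N R M))ᵀ x b * reM (QB N R M) b x'|
      ≤ ∑ b, |(reM (QB N R M))ᵀ x b * reM (QB N R M) b x'| := Finset.abs_sum_le_sum_abs _ _
    _ ≤ ∑ b, (QB N R M b x).re * ((R : ℝ) ^ d)⁻¹ := by
        refine Finset.sum_le_sum fun b _ => ?_
        rw [transpose_apply, reM_apply, reM_apply, abs_mul, abs_of_nonneg (re_QB_nonneg N R M b x), abs_of_nonneg (re_QB_nonneg N R M b x')]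
        exact mul_le_mul_of_nonneg_left (re_QB_le N R M b x') (re_QB_nonneg N R M b x)
    _ = ((R : ℝ) ^ d)⁻¹ * ((R : ℝ) ^ d)⁻¹ := by rw [← Finset.sum_mul, sum_re_QB_col]

/-- **KERNEL COERCIVITY ⟹ COERCIVITY OF THE REGULARISED FORM** (generic; PART 105's `hK` from the natural inputs): `H` symmetric with `0 ≤ ⟨u,Hu⟩ ≤ h|u|²`, coercive on
`ker Q` (`Qz = 0 ⟹ γ₀|z|² ≤ ⟨z,Hz⟩`, `γ₀ > 0`), and a right inverse `E` of `Q` with mass `|EB|² ≤ e₂|B|²`; then for `a > 0`,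
`γ_K·|u|² ≤ ⟨u,(H + Qᵀ(a•1)Q)u⟩` on ALL fields, `γ_K⁻¹ = max (4∕γ₀) ((4h·e₂∕γ₀ + 2e₂)∕a)` (`u = z + E(Qu)`, two parallelograms). [folklore] -/
theorem coercive_reg_of_ker {c ν : Type*} [Fintype c] [Fintype ν] [DecidableEq c]
    {H : Matrix ν ν ℝ} (hH : Hᵀ = H) (hpsd : ∀ z : ν → ℝ, 0 ≤ z ⬝ᵥ (H *ᵥ z)) {h : ℝ} (hh : 0 ≤ h) (hHub : ∀ u : ν → ℝ, u ⬝ᵥ (H *ᵥ u) ≤ h * (u ⬝ᵥ u))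
    {Q : Matrix c ν ℝ} {γ₀ : ℝ} (hγ₀ : 0 < γ₀) (hker : ∀ z : ν → ℝ, Q *ᵥ z = 0 → γ₀ * (z ⬝ᵥ z) ≤ z ⬝ᵥ (H *ᵥ z))
    {E : (c → ℝ) → (ν → ℝ)} {e₂ : ℝ} (hQE : ∀ B, Q *ᵥ E B = B) (hEE : ∀ B, E B ⬝ᵥ E B ≤ e₂ * (B ⬝ᵥ B))
    {a : ℝ} (ha : 0 < a) :
    QGQInverse.Coercive (H + Qᵀ * (a • (1 : Matrix c c ℝ)) * Q) (max (4 / γ₀) ((4 * h * e₂ / γ₀ + 2 * e₂) / a))⁻¹ := by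
  intro u
  rw [EffectiveFormLocalisation.form_reg]
  set C : ℝ := max (4 / γ₀) ((4 * h * e₂ / γ₀ + 2 * e₂) / a) with hC
  set B : c → ℝ := Q *ᵥ u with hB
  set w : ν → ℝ := E B with hw
  set z : ν → ℝ := u - w with hz
  have hQz : Q *ᵥ z = 0 := by rw [hz, mulVec_sub, hw, hQE, hB, sub_self]
  have hzz : γ₀ * (z ⬝ᵥ z) ≤ z ⬝ᵥ (H *ᵥ z) := hker z hQz
  have hzH : z ⬝ᵥ (H *ᵥ z) ≤ 2 * (u ⬝ᵥ (H *ᵥ u)) + 2 * (w ⬝ᵥ (H *ᵥ w)) := form_sub_le hH hpsd u w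
  have hwH : w ⬝ᵥ (H *ᵥ w) ≤ h * (w ⬝ᵥ w) := hHub w
  have hww : w ⬝ᵥ w ≤ e₂ * (B ⬝ᵥ B) := hEE B
  have huu : u ⬝ᵥ u ≤ 2 * (z ⬝ᵥ z) + 2 * (w ⬝ᵥ w) := by
    have h0 : 0 ≤ (z - w) ⬝ᵥ (z - w) := by rw [dotProduct]; exact Finset.sum_nonneg fun i _ => mul_self_nonneg _
    have e : u = z + w := by rw [hz, sub_add_cancel]
    simp only [dotProduct_sub, sub_dotProduct] at h0
    rw [e]
    simp only [dotProduct_add, add_dotProduct]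
    have hc : z ⬝ᵥ w = w ⬝ᵥ z := dotProduct_comm z w
    linarith
  have hBB : 0 ≤ B ⬝ᵥ B := by rw [dotProduct]; exact Finset.sum_nonneg fun i _ => mul_self_nonneg _
  have hww0 : 0 ≤ w ⬝ᵥ w := by rw [dotProduct]; exact Finset.sum_nonneg fun i _ => mul_self_nonneg _
  have huH : 0 ≤ u ⬝ᵥ (H *ᵥ u) := hpsd u
  -- `|z|² ≤ (2⟨u,Hu⟩ + 2h·e₂|B|²)∕γ₀`
  have h1 : z ⬝ᵥ z ≤ (2 * (u ⬝ᵥ (H *ᵥ u)) + 2 * (h * (e₂ * (B ⬝ᵥ B)))) / γ₀ := by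
    rw [le_div_iff₀ hγ₀]
    have h2 : w ⬝ᵥ (H *ᵥ w) ≤ h * (e₂ * (B ⬝ᵥ B)) := hwH.trans (mul_le_mul_of_nonneg_left hww hh)
    nlinarith
  have hmain : u ⬝ᵥ u ≤ 4 / γ₀ * (u ⬝ᵥ (H *ᵥ u)) + (4 * h * e₂ / γ₀ + 2 * e₂) * (B ⬝ᵥ B) := by
    have e : 4 / γ₀ * (u ⬝ᵥ (H *ᵥ u)) + (4 * h * e₂ / γ₀ + 2 * e₂) * (B ⬝ᵥ B)
        = 2 * ((2 * (u ⬝ᵥ (H *ᵥ u)) + 2 * (h * (e₂ * (B ⬝ᵥ B)))) / γ₀) + 2 * (e₂ * (B ⬝ᵥ B)) := by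
      field_simp
      ring
    rw [e]
    linarith
  have hC1 : 4 / γ₀ ≤ C := le_max_left _ _
  have hC2 : (4 * h * e₂ / γ₀ + 2 * e₂) / a ≤ C := le_max_right _ _
  have hC2' : 4 * h * e₂ / γ₀ + 2 * e₂ ≤ C * a := by rwa [div_le_iff₀ ha] at hC2
  have hCpos : 0 < C := lt_of_lt_of_le (div_pos four_pos hγ₀) hC1
  rw [inv_mul_le_iff₀ hCpos]
  calc u ⬝ᵥ u ≤ 4 / γ₀ * (u ⬝ᵥ (H *ᵥ u)) + (4 * h * e₂ / γ₀ + 2 * e₂) * (B ⬝ᵥ B) := hmain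
    _ ≤ C * (u ⬝ᵥ (H *ᵥ u)) + (C * a) * (B ⬝ᵥ B) := add_le_add (mul_le_mul_of_nonneg_right hC1 huH) (mul_le_mul_of_nonneg_right hC2' hBB)
    _ = C * (u ⬝ᵥ (H *ᵥ u) + a * (B ⬝ᵥ B)) := by ring

/-- **`coercive_reg_QB` — PART 105's `hK` FOR BAŁABAN's AVERAGING FROM A KERNEL COERCIVITY**: if the fine form `H` is symmetric with `0 ≤ ⟨u,Hu⟩ ≤ h|u|²` and coercive on the
fluctuation fields (`(re QB)z = 0 ⟹ γ₀|z|² ≤ ⟨z,Hz⟩`), then `H + (re QB)ᵀ(a•1)(re QB)` is coercive on ALL fields with `γ_K⁻¹ = max (4∕γ₀) ((4h·R^{2d}∕γ₀ + 2R^{2d})∕a)`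
(the corner lift as `E`, `e₂ = R^{2d}`). [folklore] -/
theorem coercive_reg_QB {H : Matrix (Tor (fine (R * N) M) × Fin d) (Tor (fine (R * N) M) × Fin d) ℝ} (hH : Hᵀ = H)
    (hpsd : ∀ z, 0 ≤ z ⬝ᵥ (H *ᵥ z)) {h : ℝ} (hh : 0 ≤ h) (hHub : ∀ u, u ⬝ᵥ (H *ᵥ u) ≤ h * (u ⬝ᵥ u)) {γ₀ : ℝ} (hγ₀ : 0 < γ₀)
    (hker : ∀ z, reM (QB N R M) *ᵥ z = 0 → γ₀ * (z ⬝ᵥ z) ≤ z ⬝ᵥ (H *ᵥ z)) {a : ℝ} (ha : 0 < a) :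
    QGQInverse.Coercive (H + (reM (QB N R M))ᵀ * (a • (1 : Matrix (Tor (fine N M) × Fin d) (Tor (fine N M) × Fin d) ℝ)) * reM (QB N R M))
      (max (4 / γ₀) ((4 * h * ((R : ℝ) ^ d) ^ 2 / γ₀ + 2 * ((R : ℝ) ^ d) ^ 2) / a))⁻¹ :=
  coercive_reg_of_ker hH hpsd hh hHub hγ₀ hker
    (E := fun B x => if (∀ ν, ((rem N R M x.1 ν : ℕ)) = R - 1) then (R : ℝ) ^ d * B (par N R M x.1, x.2) else 0)
    (reM_QB_mulVec_cornerLift N R M) (fun B => (cornerLift_dotProduct_self N R M B).le) ha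

end Letters

end Summit.QuantumFields.BalabanUV.Beta.GAN24.OneStepConstraintLettersReg

end
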